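/-
Copyright (c) 2026 the pub-hodgecm-mathlib formalisation cell (harness21).  Prover seat hodgecm-mathlib-K2E4-p17 (g0),
Track B «K2-LIT» ∕ h413, line `K2_E4_SingularTransferKappaSign`, follow-on pool item H5 (dealer K2E4-plan (g0) 21:06:32Z), part 1 of 2:
BINARY HERMITIAN PLANES inside an `n`-ary hermitian space — ANISOTROPIC IFF `−det g(p,q)` IS NOT A NORM — and the base change of an eigenplane.  2026-09-03.
-/
import Literature.NumberTheory.Rogawski1990.KottwitzSignTwistedPlane   -- ★ `forall_hermForm_eq_zero_iff_not_exists_mul_self_eq_neg_det` (binary plane over a field), ★ `hermForm_two`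
import HarnessLib

/-!
# K2_E4 road (h413 = stmt-HodgeConjecture-24833), pool item H5, part 1: hermitian planes `Rp + Rq ⊂ (R^n, H)` — anisotropic iff
# `−det g(p,q) ∉ {σ(z) z}` — and the base change of the `e₁`-eigenplane `ker (M − e₁)` along a ring map

Cell `pub/hodgecm-mathlib` (D-0151), Track B (21-frontier RULING «PUSH BOTH» 2026-09-03, director req624, chair K2-lead ORDER #1 §4.4 ∕ ORDER #2,
naming rule s1813), dealer's pool `K2/K2E4-plan/g0/DEALS.K2E4-g0.md` item **H5** (consumers: sockets #8 `sig_K2E4KottwitzSignOfSheets`, #18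
`sig_K2E4KottwitzSignParity` of `Cruxes/H413/Lines/K2_E4_SingularTransferKappaSign*`; part 2 = `Theorems/K2E4EigenplaneAnisotropicIffHilbertSymbol.lean`,
the CM readings as Hilbert symbols).  PURE ALGEBRA over commutative rings; no number field, no measure, no transfer.

THE MATHEMATICS.  For a field `K` with a ring endomorphism `σ` and a binary `σ`-hermitian Gram matrix `g`, the plane is ANISOTROPIC iff `−det g` is NOT a norm
`σ(z) z` (completing the square `g₀₀·⟨u,u⟩ = N(g₀₀u₀ + g₀₁u₁) + det g · N(u₁)`): ★ `forall_hermForm_eq_zero_iff_not_exists_mul_self_eq_neg_det` (★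
`KottwitzSignTwistedPlane`), the rank-2 case of [Jacobowitz1962, Thm. 3.1], reused BY NAME.  This file adds what the consumers need around it:
* §1 coordinates: the sockets' double sum `Σ_{i,j} σ(x_i) H_{ij} x_j` is ★ `hermForm σ H x x`; sesquilinearity; the RESTRICTION of an `n`-ary form to
  `Rp + Rq` is the binary form with Gram matrix `g(p,q) = (⟨p,p⟩ ⟨p,q⟩; ⟨q,p⟩ ⟨q,q⟩)` (`hermForm_lincomb_self_eq_gram`), `σ`-hermitian when `H` is
  (`gram_hermitian`); Gram matrices and hermitian-ness commute with compatible ring maps (`gram_map`, `hermitian_map`, `neg_det_gram_map`).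
* §2 the PLANE criterion over a commutative ring that IS a field (`IsField R`: the tree's `E_v = ∏_{w∣v} L_w` at a non-split `v` is a field but carries no
  `Field` instance): **`plane_anisotropic_iff_not_exists_norm`** `(∀ a b, ⟨ap+bq, ap+bq⟩ = 0 → ap+bq = 0) ↔ ¬ ∃ z, σ(z) z = −det g(p,q)` for independent
  `p, q`, `…_of_iff` for a plane given by any predicate `P` with `P x ↔ x ∈ Rp + Rq`, and `det_gram_ne_zero_of_separating` (non-degenerate ⇒ `det g ≠ 0`).
* §3 BASE CHANGE along `f : K →+* R` (`K` a field): if `(M − e₁)(M − e₂) = 0`, `f(e₁ − e₂)` is a unit and `p, q` is a `K`-basis of `ker (M − e₁)`, then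
  **`ker_baseChange_iff`** `(M^f − f(e₁)) x = 0 ↔ x ∈ R f(p) + R f(q)` (as `ker (M − e₁) = im (M − e₂)`, spanned by the columns of `M − e₂`), and
  **`indep_baseChange`** `f(p), f(q)` stay independent when `R` is a field (a non-zero `2 × 2` minor, `exists_minor_ne_zero`); the glue
  **`exists_pair_of_finrank_ker_eq_two`** from `finrank_K ker = 2` (pool item H1's currency) to such a pair.

HONEST LABEL: HC_CM is proved only modulo the 7 printed citations (2 remaining named inputs: hLiu418 = stmt-HodgeConjecture-24832, h413 =
stmt-HodgeConjecture-24833) until rung 0 closes; this file is a `--supports stmt-HodgeConjecture-24833` helper and retires nothing by itself.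

## References
* [Jacobowitz1962] R. Jacobowitz, *Hermitian forms over local fields*, Amer. J. Math. 84 (1962), §3 Thm. 3.1 (rank and discriminant class).
* [Scharlau1985HermitianForms] W. Scharlau, *Quadratic and Hermitian Forms*, Grundlehren 270 (1985), Ch. 10 §1 (hermitian forms over a field with involution).
* [Rogawski1990] J. D. Rogawski, *Automorphic Representations of Unitary Groups in Three Variables*, Ann. of Math. Stud. 123 (1990), §3.8 p. 33
  (`F_v^*∕NE_v^*` classifies the planes), §8.1 p. 117.
-/

set_option autoImplicit false
-- the mandated namespace repeats the single-problem summit's segment (`HodgeConjecture.HodgeConjecture`)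
set_option linter.dupNamespace false

noncomputable section

open Matrix NumberField IsDedekindDomain
open Literature.AlgebraicGeometry.ShimuraVarieties (hermForm)
open Literature.NumberTheory.Rogawski1990 (hermForm_two forall_hermForm_eq_zero_iff_not_exists_mul_self_eq_neg_det)

namespace Summit.HodgeConjecture.HodgeConjecture.Cruxes.H413.K2E4HermitianPlaneIsotropicIffNorm

/-! ## §1 Coordinates: the double sum, sesquilinearity, the Gram matrix of two vectors -/

section Coordinates

variable {R : Type*} [CommRing R] (σ : R →+* R) {n : Type*} [Fintype n]

/-- The sockets' double sum `Σ_{i,j} σ(x_i) H_{ij} y_j` is ★ `hermForm σ H x y`. [folklore] -/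
theorem sum_sum_mul_mul_eq_hermForm (H : Matrix n n R) (x y : n → R) :
    (∑ i, ∑ j, σ (x i) * H i j * y j) = hermForm σ H x y := by
  simp only [hermForm, dotProduct, Matrix.mulVec, Function.comp_apply, Finset.mul_sum, mul_assoc]

/-- `σ`-semilinearity in the first variable. [folklore] -/
theorem hermForm_lincomb_left (H : Matrix n n R) (a b : R) (p q w : n → R) :
    hermForm σ H (a • p + b • q) w = σ a * hermForm σ H p w + σ b * hermForm σ H q w := by
  simp only [hermForm, dotProduct, Function.comp_apply, Pi.add_apply, Pi.smul_apply, smul_eq_mul, map_add, map_mul,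
    add_mul, Finset.sum_add_distrib, Finset.mul_sum, mul_assoc]

/-- Linearity in the second variable. [folklore] -/
theorem hermForm_lincomb_right (H : Matrix n n R) (a b : R) (w p q : n → R) :
    hermForm σ H w (a • p + b • q) = a * hermForm σ H w p + b * hermForm σ H w q := by
  simp only [hermForm, Matrix.mulVec_add, Matrix.mulVec_smul, dotProduct_add, dotProduct_smul, smul_eq_mul]

/-- **Restriction to a plane**: `⟨a′p + b′q, ap + bq⟩_H = ⟨(a′,b′), (a,b)⟩_{g(p,q)}` for the Gram matrix `g(p,q) = (⟨p,p⟩ ⟨p,q⟩; ⟨q,p⟩ ⟨q,q⟩)`.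
[cite: Jacobowitz1962, §3] -/
theorem hermForm_lincomb_lincomb_eq_gram (H : Matrix n n R) (a' b' a b : R) (p q : n → R) :
    hermForm σ H (a' • p + b' • q) (a • p + b • q) =
      hermForm σ !![hermForm σ H p p, hermForm σ H p q; hermForm σ H q p, hermForm σ H q q] ![a', b'] ![a, b] := by
  rw [hermForm_lincomb_left, hermForm_lincomb_right, hermForm_lincomb_right]
  simp only [hermForm, dotProduct, Matrix.mulVec, Fin.sum_univ_two, Function.comp_apply, Matrix.of_apply, Matrix.cons_val',
    Matrix.cons_val_zero, Matrix.cons_val_one, Matrix.empty_val', Matrix.cons_val_fin_one]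
  ring

/-- In particular `⟨ap + bq, ap + bq⟩_H = ⟨(a,b), (a,b)⟩_{g(p,q)}`. [cite: Jacobowitz1962, §3] -/
theorem hermForm_lincomb_self_eq_gram (H : Matrix n n R) (a b : R) (p q : n → R) :
    hermForm σ H (a • p + b • q) (a • p + b • q) =
      hermForm σ !![hermForm σ H p p, hermForm σ H p q; hermForm σ H q p, hermForm σ H q q] ![a, b] ![a, b] :=
  hermForm_lincomb_lincomb_eq_gram σ H a b a b p q

/-- `σ ⟨u, v⟩ = ⟨v, u⟩` for a `σ`-hermitian `H` and an involution `σ`. [folklore] -/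
theorem map_hermForm_eq_swap (hσ : ∀ x, σ (σ x) = x) {H : Matrix n n R} (hH : (H.map σ)ᵀ = H) (u v : n → R) :
    σ (hermForm σ H u v) = hermForm σ H v u := by
  have hij : ∀ i j, σ (H i j) = H j i := fun i j => by
    have h := congrFun (congrFun hH j) i
    rwa [Matrix.transpose_apply, Matrix.map_apply] at h
  simp only [hermForm, dotProduct, Matrix.mulVec, Function.comp_apply, map_sum, map_mul, hσ, hij, Finset.mul_sum]
  rw [Finset.sum_comm]
  exact Finset.sum_congr rfl fun i _ => Finset.sum_congr rfl fun j _ => by ring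

/-- The Gram matrix of two vectors is `σ`-hermitian (involutive `σ`, hermitian `H`). [folklore] -/
theorem gram_hermitian (hσ : ∀ x, σ (σ x) = x) {H : Matrix n n R} (hH : (H.map σ)ᵀ = H) (p q : n → R) :
    ((!![hermForm σ H p p, hermForm σ H p q; hermForm σ H q p, hermForm σ H q q]).map σ)ᵀ =
      !![hermForm σ H p p, hermForm σ H p q; hermForm σ H q p, hermForm σ H q q] := by
  ext i j
  fin_cases i <;> fin_cases j <;> simp [Matrix.transpose_apply, Matrix.map_apply, map_hermForm_eq_swap σ hσ hH]

variable {S : Type*} [CommRing S] (τ : S →+* S) (f : R →+* S)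

/-- A ring map `f` with `f ∘ σ = τ ∘ f` carries `⟨u, v⟩_H` to `⟨fu, fv⟩_{f H}`. [folklore] -/
theorem ringHom_map_hermForm (hf : ∀ x, f (σ x) = τ (f x)) (H : Matrix n n R) (u v : n → R) :
    f (hermForm σ H u v) = hermForm τ (H.map f) (f ∘ u) (f ∘ v) := by
  simp only [hermForm, dotProduct, Matrix.mulVec, Function.comp_apply, map_sum, map_mul, hf, Matrix.map_apply]

/-- Gram matrices commute with ring maps: `f g(p,q) = g(fp, fq)` (for `f H`, `τ`). [folklore] -/
theorem gram_map (hf : ∀ x, f (σ x) = τ (f x)) (H : Matrix n n R) (p q : n → R) :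
    (!![hermForm σ H p p, hermForm σ H p q; hermForm σ H q p, hermForm σ H q q]).map f =
      !![hermForm τ (H.map f) (f ∘ p) (f ∘ p), hermForm τ (H.map f) (f ∘ p) (f ∘ q);
        hermForm τ (H.map f) (f ∘ q) (f ∘ p), hermForm τ (H.map f) (f ∘ q) (f ∘ q)] := by
  ext i j
  fin_cases i <;> fin_cases j <;> simp [Matrix.map_apply, ringHom_map_hermForm σ τ f hf]

/-- A `σ`-hermitian matrix stays hermitian after a compatible ring map: `((g^f)^τ)ᵀ = g^f`. [folklore] -/
theorem hermitian_map {m : Type*} (hf : ∀ x, f (σ x) = τ (f x)) {g : Matrix m m R} (hg : (g.map σ)ᵀ = g) :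
    ((g.map f).map τ)ᵀ = g.map f := by
  conv_rhs => rw [← hg]
  ext i j
  simp only [Matrix.transpose_apply, Matrix.map_apply, hf]

/-- … so `−det g(fp, fq) = f(−det g(p,q))` (Mathlib `RingHom.map_det`). [folklore] -/
theorem neg_det_gram_map (hf : ∀ x, f (σ x) = τ (f x)) (H : Matrix n n R) (p q : n → R) :
    -(!![hermForm τ (H.map f) (f ∘ p) (f ∘ p), hermForm τ (H.map f) (f ∘ p) (f ∘ q);
        hermForm τ (H.map f) (f ∘ q) (f ∘ p), hermForm τ (H.map f) (f ∘ q) (f ∘ q)]).det =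
      f (-(!![hermForm σ H p p, hermForm σ H p q; hermForm σ H q p, hermForm σ H q q]).det) := by
  rw [← gram_map σ τ f hf, map_neg, RingHom.map_det, RingHom.mapMatrix_apply]

end Coordinates

/-! ## §2 The plane criterion over a commutative ring which is a field -/

section Plane

variable {R : Type*} [CommRing R] (σ : R →+* R) {n : Type*} [Fintype n]

/-- **A non-degenerate-or-not hermitian PLANE `Rp + Rq` (independent `p, q`) inside `(R^n, H)` is ANISOTROPIC iff `−det g(p,q)` is NOT a norm `σ(z) z`**,
`R` a commutative ring which is a field (`IsField`), `g(p,q)` `σ`-hermitian — the restriction is the binary form `g(p,q)` (§1) and ★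
`forall_hermForm_eq_zero_iff_not_exists_mul_self_eq_neg_det` (completing the square). [cite: Jacobowitz1962, §3 Thm. 3.1] [cite: Rogawski1990, §3.8 p. 33] -/
theorem plane_anisotropic_iff_not_exists_norm (hR : IsField R) {H : Matrix n n R} {p q : n → R}
    (hG : ((!![hermForm σ H p p, hermForm σ H p q; hermForm σ H q p, hermForm σ H q q]).map σ)ᵀ =
      !![hermForm σ H p p, hermForm σ H p q; hermForm σ H q p, hermForm σ H q q])
    (hind : ∀ a b : R, a • p + b • q = 0 → a = 0 ∧ b = 0) :
    (∀ a b : R, hermForm σ H (a • p + b • q) (a • p + b • q) = 0 → a • p + b • q = 0) ↔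
      ¬ ∃ z : R, σ z * z = -(!![hermForm σ H p p, hermForm σ H p q; hermForm σ H q p, hermForm σ H q q]).det := by
  have hplane : (∀ a b : R, hermForm σ H (a • p + b • q) (a • p + b • q) = 0 → a • p + b • q = 0) ↔
      ∀ u : Fin 2 → R, hermForm σ !![hermForm σ H p p, hermForm σ H p q; hermForm σ H q p, hermForm σ H q q] u u = 0 → u = 0 := by
    constructor
    · intro h u hu
      have hu2 : (![u 0, u 1] : Fin 2 → R) = u := by ext i; fin_cases i <;> rfl
      have hu' : hermForm σ H (u 0 • p + u 1 • q) (u 0 • p + u 1 • q) = 0 := by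
        rw [hermForm_lincomb_self_eq_gram, hu2]; exact hu
      obtain ⟨h0, h1⟩ := hind _ _ (h _ _ hu')
      rw [← hu2, h0, h1]
      ext i; fin_cases i <;> rfl
    · intro h a b hab
      rw [hermForm_lincomb_self_eq_gram] at hab
      have h0 := h _ hab
      have ha : a = 0 := by simpa using congrFun h0 0
      have hb : b = 0 := by simpa using congrFun h0 1
      rw [ha, hb, zero_smul, zero_smul, add_zero]
  letI : Field R := hR.toField
  exact hplane.trans (forall_hermForm_eq_zero_iff_not_exists_mul_self_eq_neg_det σ _ hG)

/-- The same with the plane given by any predicate `P` with `P x ↔ x ∈ Rp + Rq`. [cite: Jacobowitz1962, §3 Thm. 3.1] -/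
theorem plane_anisotropic_iff_not_exists_norm_of_iff (hR : IsField R) {H : Matrix n n R} {p q : n → R}
    (hG : ((!![hermForm σ H p p, hermForm σ H p q; hermForm σ H q p, hermForm σ H q q]).map σ)ᵀ =
      !![hermForm σ H p p, hermForm σ H p q; hermForm σ H q p, hermForm σ H q q])
    (hind : ∀ a b : R, a • p + b • q = 0 → a = 0 ∧ b = 0) {P : (n → R) → Prop} (hP : ∀ x, P x ↔ ∃ a b : R, x = a • p + b • q) :
    (∀ x : n → R, P x → hermForm σ H x x = 0 → x = 0) ↔
      ¬ ∃ z : R, σ z * z = -(!![hermForm σ H p p, hermForm σ H p q; hermForm σ H q p, hermForm σ H q q]).det := by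
  rw [← plane_anisotropic_iff_not_exists_norm σ hR hG hind]
  constructor
  · intro h a b hab
    exact h _ ((hP _).2 ⟨a, b, rfl⟩) hab
  · intro h x hx hxx
    obtain ⟨a, b, rfl⟩ := (hP x).1 hx
    exact h a b hxx

/-- **Non-degeneracy of the plane ⇒ `det g(p,q) ≠ 0`** (`R` a field as a ring, `p, q` independent): if the only `ap + bq` orthogonal to the whole plane is
`0`, the Gram matrix is non-singular (a kernel vector of `g(p,q)` is orthogonal to the plane; Mathlib `Matrix.exists_mulVec_eq_zero_iff`).
[cite: Scharlau1985HermitianForms, Ch. 10 §1] -/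
theorem det_gram_ne_zero_of_separating (hR : IsField R) {H : Matrix n n R} {p q : n → R}
    (hind : ∀ a b : R, a • p + b • q = 0 → a = 0 ∧ b = 0)
    (hsep : ∀ a b : R, (∀ a' b' : R, hermForm σ H (a' • p + b' • q) (a • p + b • q) = 0) → a • p + b • q = 0) :
    (!![hermForm σ H p p, hermForm σ H p q; hermForm σ H q p, hermForm σ H q q]).det ≠ 0 := by
  intro hdet
  letI : Field R := hR.toField
  obtain ⟨u, hu0, hu⟩ := Matrix.exists_mulVec_eq_zero_iff.2 hdet
  have horth : ∀ a' b' : R, hermForm σ H (a' • p + b' • q) (u 0 • p + u 1 • q) = 0 := fun a' b' => by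
    have hu2 : (![u 0, u 1] : Fin 2 → R) = u := by ext i; fin_cases i <;> rfl
    rw [hermForm_lincomb_lincomb_eq_gram, hu2, hermForm, hu, dotProduct_zero]
  obtain ⟨h0, h1⟩ := hind _ _ (hsep _ _ horth)
  exact hu0 (by ext i; fin_cases i <;> simp [h0, h1])

end Plane

/-! ## §3 Base change of the `e₁`-eigenplane along a ring map -/

section BaseChange

variable {K : Type*} [Field K] {R : Type*} [CommRing R] (f : K →+* R) {n : Type*} [Fintype n] [DecidableEq n]

omit [Fintype n] in
/-- `(M − e·1)^f = M^f − f(e)·1`. [folklore] -/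
theorem map_sub_smul_one (M : Matrix n n K) (e : K) :
    (M - e • (1 : Matrix n n K)).map f = M.map f - f e • (1 : Matrix n n R) := by
  ext i j
  simp only [Matrix.map_apply, Matrix.sub_apply, Matrix.smul_apply, Matrix.one_apply, smul_eq_mul, mul_ite, mul_one,
    mul_zero, map_sub]
  split_ifs <;> simp

/-- The columns of `M − e₂` lie in `ker (M − e₁)` when `(M − e₁)(M − e₂) = 0`. [folklore] -/
theorem mulVec_col_eq_zero (M : Matrix n n K) (e₁ e₂ : K) (hM : (M - e₁ • (1 : Matrix n n K)) * (M - e₂ • (1 : Matrix n n K)) = 0) (j : n) :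
    (M - e₁ • (1 : Matrix n n K)) *ᵥ (fun k => (M - e₂ • (1 : Matrix n n K)) k j) = 0 := by
  funext i
  have h := congrFun (congrFun hM i) j
  rw [Matrix.mul_apply] at h
  simpa [Matrix.mulVec, dotProduct] using h

/-- **BASE CHANGE OF THE EIGENPLANE.**  If `(M − e₁)(M − e₂) = 0`, `f(e₁ − e₂)` is a unit, and `p, q ∈ ker (M − e₁)` span it over `K`, then over `R`:
`(M^f − f(e₁)) x = 0 ↔ x ∈ R·f(p) + R·f(q)` (`ker (M − e₁) = im (M − e₂)`: `x = f(e₁−e₂)⁻¹ (M^f − f(e₂)) x`, a combination of the columns of `M − e₂`).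
[folklore] -/
theorem ker_baseChange_iff (M : Matrix n n K) {e₁ e₂ : K} (hM : (M - e₁ • (1 : Matrix n n K)) * (M - e₂ • (1 : Matrix n n K)) = 0)
    (hu : IsUnit (f (e₁ - e₂))) {p q : n → K} (hp : (M - e₁ • (1 : Matrix n n K)) *ᵥ p = 0) (hq : (M - e₁ • (1 : Matrix n n K)) *ᵥ q = 0)
    (hspan : ∀ y : n → K, (M - e₁ • (1 : Matrix n n K)) *ᵥ y = 0 → ∃ a b : K, y = a • p + b • q) (x : n → R) :
    (M.map f - f e₁ • (1 : Matrix n n R)) *ᵥ x = 0 ↔ ∃ a b : R, x = a • (f ∘ p) + b • (f ∘ q) := by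
  constructor
  · intro hx
    choose a b hab using fun j => hspan _ (mulVec_col_eq_zero M e₁ e₂ hM j)
    obtain ⟨u, hu⟩ := hu
    have h2 : (M.map f - f e₂ • (1 : Matrix n n R)) *ᵥ x = f (e₁ - e₂) • x := by
      have : M.map f - f e₂ • (1 : Matrix n n R) = (M.map f - f e₁ • (1 : Matrix n n R)) + f (e₁ - e₂) • (1 : Matrix n n R) := by
        rw [map_sub, sub_smul]; abel
      rw [this, Matrix.add_mulVec, hx, zero_add, Matrix.smul_mulVec, Matrix.one_mulVec]
    have h3 : (M.map f - f e₂ • (1 : Matrix n n R)) *ᵥ x =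
        (∑ j, f (a j) * x j) • (f ∘ p) + (∑ j, f (b j) * x j) • (f ∘ q) := by
      funext i
      have hcol : ∀ j, (M.map f - f e₂ • (1 : Matrix n n R)) i j = f (a j) * f (p i) + f (b j) * f (q i) := by
        intro j
        have h := congrFun (hab j) i
        simp only [Pi.add_apply, Pi.smul_apply, smul_eq_mul] at h
        rw [← map_sub_smul_one, Matrix.map_apply, h, map_add, map_mul, map_mul]
      simp only [Matrix.mulVec, dotProduct, hcol, Pi.add_apply, Pi.smul_apply, Function.comp_apply, smul_eq_mul,
        add_mul, Finset.sum_add_distrib, Finset.sum_mul]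
      congr 1 <;> exact Finset.sum_congr rfl fun j _ => by ring
    refine ⟨↑u⁻¹ * ∑ j, f (a j) * x j, ↑u⁻¹ * ∑ j, f (b j) * x j, ?_⟩
    have hx' : x = (↑u⁻¹ : R) • ((M.map f - f e₂ • (1 : Matrix n n R)) *ᵥ x) := by
      rw [h2, ← hu, smul_smul, Units.inv_mul, one_smul]
    rw [h3, smul_add, smul_smul, smul_smul] at hx'
    exact hx'
  · rintro ⟨a, b, rfl⟩
    have hker : ∀ r : n → K, (M - e₁ • (1 : Matrix n n K)) *ᵥ r = 0 → (M.map f - f e₁ • (1 : Matrix n n R)) *ᵥ (f ∘ r) = 0 := by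
      intro r hr
      funext i
      rw [← map_sub_smul_one, ← RingHom.map_mulVec, hr, Pi.zero_apply, Pi.zero_apply, map_zero]
    rw [Matrix.mulVec_add, Matrix.mulVec_smul, Matrix.mulVec_smul, hker p hp, hker q hq, smul_zero, smul_zero, add_zero]

omit [Fintype n] [DecidableEq n] in
/-- Independent `p, q ∈ K^n` have a non-zero `2 × 2` minor. [folklore] -/
theorem exists_minor_ne_zero {p q : n → K} (hind : ∀ a b : K, a • p + b • q = 0 → a = 0 ∧ b = 0) :
    ∃ i j, p i * q j - p j * q i ≠ 0 := by
  by_contra hall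
  push Not at hall
  have hp0 : p ≠ 0 := by
    intro hp
    exact one_ne_zero (hind 1 0 (by rw [hp, smul_zero, zero_smul, add_zero])).1
  obtain ⟨i₀, hi₀⟩ := Function.ne_iff.1 hp0
  have hi₀' : p i₀ ≠ 0 := hi₀
  set c : K := q i₀ / p i₀ with hc
  have hq : q = c • p := by
    funext j
    have h := hall i₀ j
    rw [sub_eq_zero] at h
    rw [Pi.smul_apply, smul_eq_mul, hc, div_mul_eq_mul_div, eq_div_iff hi₀']
    linear_combination h
  have h1 := (hind c (-1) (by rw [hq, neg_one_smul, add_neg_cancel])).2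
  exact neg_ne_zero.2 one_ne_zero h1

omit [Fintype n] [DecidableEq n] in
/-- **Independence survives base change** to a commutative ring which is a field (a non-zero minor maps to a unit). [folklore] -/
theorem indep_baseChange (hR : IsField R) {p q : n → K} (hind : ∀ a b : K, a • p + b • q = 0 → a = 0 ∧ b = 0) :
    ∀ a b : R, a • (f ∘ p) + b • (f ∘ q) = 0 → a = 0 ∧ b = 0 := by
  haveI : Nontrivial R := ⟨hR.exists_pair_ne⟩
  obtain ⟨i, j, hm⟩ := exists_minor_ne_zero hind
  have hfm : f (p i * q j - p j * q i) ≠ 0 := (map_ne_zero f).2 hm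
  obtain ⟨w, hw⟩ := hR.mul_inv_cancel hfm
  have hfm' : f (p i * q j - p j * q i) = f (p i) * f (q j) - f (p j) * f (q i) := by rw [map_sub, map_mul, map_mul]
  intro a b hab
  have hi := congrFun hab i
  have hj := congrFun hab j
  simp only [Pi.add_apply, Pi.smul_apply, Function.comp_apply, smul_eq_mul, Pi.zero_apply] at hi hj
  constructor
  · have h : a * f (p i * q j - p j * q i) = 0 := by
      rw [hfm']; linear_combination (f (q j)) * hi - (f (q i)) * hj
    calc a = a * (f (p i * q j - p j * q i) * w) := by rw [hw, mul_one]
      _ = 0 := by rw [← mul_assoc, h, zero_mul]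
  · have h : b * f (p i * q j - p j * q i) = 0 := by
      rw [hfm']; linear_combination (f (p i)) * hj - (f (p j)) * hi
    calc b = b * (f (p i * q j - p j * q i) * w) := by rw [hw, mul_one]
      _ = 0 := by rw [← mul_assoc, h, zero_mul]

/-- **Glue to H1's currency**: from `finrank_K ker (N) = 2` to a pair `p, q ∈ ker N`, independent and spanning. [folklore] -/
theorem exists_pair_of_finrank_ker_eq_two (N : Matrix n n K) (h2 : Module.finrank K (LinearMap.ker (Matrix.toLin' N)) = 2) :
    ∃ p q : n → K, N *ᵥ p = 0 ∧ N *ᵥ q = 0 ∧ (∀ a b : K, a • p + b • q = 0 → a = 0 ∧ b = 0) ∧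
      (∀ y : n → K, N *ᵥ y = 0 → ∃ a b : K, y = a • p + b • q) := by
  let bW := Module.finBasisOfFinrankEq K (LinearMap.ker (Matrix.toLin' N)) h2
  refine ⟨(bW 0 : LinearMap.ker (Matrix.toLin' N)), (bW 1 : LinearMap.ker (Matrix.toLin' N)), ?_, ?_, ?_, ?_⟩
  · have h := LinearMap.mem_ker.1 (bW 0).2
    rwa [Matrix.toLin'_apply] at h
  · have h := LinearMap.mem_ker.1 (bW 1).2
    rwa [Matrix.toLin'_apply] at h
  · intro a b hab
    have hab' : a • bW 0 + b • bW 1 = 0 := by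
      apply Subtype.ext
      rw [Submodule.coe_add, Submodule.coe_smul, Submodule.coe_smul, Submodule.coe_zero]
      exact hab
    have hli := Fintype.linearIndependent_iff.1 bW.linearIndependent ![a, b] (by rw [Fin.sum_univ_two]; exact hab')
    exact ⟨hli 0, hli 1⟩
  · intro y hy
    have hyW : y ∈ LinearMap.ker (Matrix.toLin' N) := by rw [LinearMap.mem_ker, Matrix.toLin'_apply]; exact hy
    refine ⟨bW.repr ⟨y, hyW⟩ 0, bW.repr ⟨y, hyW⟩ 1, ?_⟩
    have h := bW.sum_repr ⟨y, hyW⟩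
    rw [Fin.sum_univ_two] at h
    have h' := congrArg Subtype.val h
    rw [Submodule.coe_add, Submodule.coe_smul, Submodule.coe_smul] at h'
    exact h'.symm

end BaseChange

end Summit.HodgeConjecture.HodgeConjecture.Cruxes.H413.K2E4HermitianPlaneIsotropicIffNorm

end
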